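import Mathlib.Algebra.BigOperators.Fin
import Mathlib.Logic.Equiv.Fin.Basic
import Summits.HubbardSuperconductivity.HubbardSuperconductivity.Theorems.AnisotropyChordFourTorusPacking
import Summits.HubbardSuperconductivity.HubbardSuperconductivity.Theorems.AnisotropyChordTowerPerturbation
import Summits.HubbardSuperconductivity.HubbardSuperconductivity.Theorems.AnisotropyChordInsertionEntropyUniformDensity
import Summits.HubbardSuperconductivity.HubbardSuperconductivity.Theorems.AnisotropyChordTowerParticleHole

/-!
# Route `AnisotropyChord` / crux `FerroSideChord` at `M = 4`: CODES OF CONFIGURATIONS and THE SYMMETRIES ON CODES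
(prover seat `hubbard-h0-rotor-p1` g17)

Part A — the bridge between the tree's configurations `σ : TorusSite 2 4 → Fin 2` and the kernel's codes `k < 2^16`:
`siteEquiv : TorusSite 2 4 ≃ Fin 16` (`x ↦ x 1 + 4·x 0`), `codeEquiv`, `decode k` (bit `siteEquiv x` set ⇔ `σ x = 1`),
`sum_config_eq_sum_range` (`Σ_σ F σ = Σ_{k<65536} F (decode k)`), `zerosCard_decode` (`= 16 − bitCount k`), `pop16_eq_bitCount`
(kernel fact), `adj16_iff` (the adjacency table IS the torus adjacency, `decide`), `torus4_degree_sum` (`= 64`).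
Part B — `sitePerm p m` / `siteIso p m` (`p < 24`, `m < 16`): the kernel's site map IS a graph automorphism (kernel fact `siteMap_spec`);
`decode_moveBits`, `decode_flipMask`, `decode_actCode_even/odd`, `actCode_lt`: the code action is "relabel by the automorphism, then
(odd `t`) flip all spins"; **`perron_decode_actCode`** — the sector-`0` Perron amplitude of `H₄(Δ)` takes equal values on
`decode (actCode t k)` and `decode k` (tree: `perronAmplitude_comp_iso`, `perron_neg_eq_flip`).
-/

set_option linter.style.longLine false
set_option linter.dupNamespace false
set_option autoImplicit false

open Finset
open Literature.MathematicalPhysics.QuantumLattice Literature.Probability.LatticeModels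
open Summit.HubbardSuperconductivity.HubbardSuperconductivity.Theorems.AnisotropyChord.Tower
open Summit.HubbardSuperconductivity.HubbardSuperconductivity.Theorems.AnisotropyChord.InsertionEntropy

namespace Summit.HubbardSuperconductivity.HubbardSuperconductivity.Theorems.AnisotropyChord.FourTorus


/-- the sites of the `4 × 4` torus. [folklore] -/
abbrev V4 : Type := TorusSite 2 4

/-- configurations of the `4 × 4` torus. [folklore] -/
abbrev Cfg : Type := V4 → Fin 2

/-- site `x ↦ x 1 + 4 · x 0 ∈ Fin 16`. [folklore] -/
def siteEquiv : V4 ≃ Fin 16 := (finTwoArrowEquiv (ZMod 4)).trans finProdFinEquiv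

/-- configuration `↦` code `< 2^16` (bit `siteEquiv x` set iff `σ x = 1`). [folklore] -/
def codeEquiv : Cfg ≃ Fin 65536 := (siteEquiv.arrowCongr (Equiv.refl (Fin 2))).trans finFunctionFinEquiv

/-- the configuration of a code: `σ x = 1` iff bit `siteEquiv x` of `k` is set. [folklore] -/
def decode (k : ℕ) : Cfg := fun x => if Nat.testBit k (siteEquiv x) then 1 else 0

/-- `codeEquiv.symm` is `decode`. [folklore] -/
theorem codeEquiv_symm_eq_decode (k : Fin 65536) : codeEquiv.symm k = decode k := by
  funext x
  unfold codeEquiv decode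
  simp only [Equiv.symm_trans_apply, Equiv.arrowCongr_symm, Equiv.arrowCongr_apply,
    Function.comp_apply, Equiv.symm_symm]
  apply Fin.ext
  rw [show ((Equiv.refl (Fin 2)).symm ((finFunctionFinEquiv.symm k) (siteEquiv x))) = (finFunctionFinEquiv.symm k) (siteEquiv x)
    from rfl, finFunctionFinEquiv_symm_apply_val, Nat.testBit_eq_decide_div_mod_eq]
  have h2 : (k : ℕ) / 2 ^ ((siteEquiv x : Fin 16) : ℕ) % 2 < 2 := Nat.mod_lt _ (by norm_num)
  rcases Nat.lt_succ_iff_lt_or_eq.1 h2 with h | h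
  · have h0 : (k : ℕ) / 2 ^ ((siteEquiv x : Fin 16) : ℕ) % 2 = 0 := by omega
    rw [h0]; simp
  · rw [h]; simp

/-- **sum transfer:** `Σ_σ F σ = Σ_{k<65536} F (decode k)`. [folklore] -/
theorem sum_config_eq_sum_range {β : Type} [AddCommMonoid β] (F : Cfg → β) :
    ∑ σ, F σ = ∑ k ∈ range 65536, F (decode k) := by
  rw [← Equiv.sum_comp codeEquiv.symm F, ← Fin.sum_univ_eq_sum_range (fun k => F (decode k)) 65536]
  exact Fintype.sum_congr _ _ fun k => by rw [codeEquiv_symm_eq_decode]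

/-- `decode k x = 1 ↔` the bit is set. [folklore] -/
theorem decode_eq_one_iff (k : ℕ) (x : V4) : decode k x = 1 ↔ Nat.testBit k (siteEquiv x) = true := by
  unfold decode; split_ifs with h <;> simp [h]

/-- `decode k x = 0 ↔` the bit is not set. [folklore] -/
theorem decode_eq_zero_iff (k : ℕ) (x : V4) : decode k x = 0 ↔ Nat.testBit k (siteEquiv x) = false := by
  unfold decode; split_ifs with h <;> simp [h]

/-- `bitCount` as a sum of bit indicators. [folklore] -/
theorem bitCount_eq (k : ℕ) : bitCount k = ∑ i ∈ range 16, (if Nat.testBit k i then 1 else 0) := by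
  unfold bitCount; rw [sumN_eq]; exact Finset.sum_congr rfl fun i _ => by cases Nat.testBit k i <;> rfl

/-- `bitCount k ≤ 16`. [folklore] -/
theorem bitCount_le (k : ℕ) : bitCount k ≤ 16 := by
  rw [bitCount_eq]
  calc ∑ i ∈ range 16, (if Nat.testBit k i then 1 else 0) ≤ ∑ _i ∈ range 16, 1 :=
        Finset.sum_le_sum fun i _ => by split_ifs <;> omega
    _ = 16 := by simp

/-- **number of zeros of a decoded configuration:** `zerosCard (decode k) = 16 − bitCount k`. [folklore] -/
theorem zerosCard_decode (k : ℕ) : zerosCard (decode k) = 16 - (bitCount k : ℝ) := by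
  unfold zerosCard
  have hones : ((univ.filter fun x : V4 => decode k x = 0).card : ℝ)
      = 16 - ((univ.filter fun x : V4 => Nat.testBit k (siteEquiv x) = true).card : ℝ) := by
    have h := Finset.card_filter_add_card_filter_not (s := (univ : Finset V4)) (fun x => Nat.testBit k (siteEquiv x) = true)
    have hneg : (univ.filter fun x : V4 => ¬ Nat.testBit k (siteEquiv x) = true) = (univ.filter fun x : V4 => decode k x = 0) := by
      ext x; simp [decode_eq_zero_iff]
    rw [hneg, Finset.card_univ] at h
    have hcard : Fintype.card V4 = 16 := by rw [Fintype.card_congr siteEquiv, Fintype.card_fin]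
    rw [hcard] at h
    have : ((univ.filter fun x : V4 => decode k x = 0).card : ℝ)
        + ((univ.filter fun x : V4 => Nat.testBit k (siteEquiv x) = true).card : ℝ) = 16 := by exact_mod_cast (by omega)
    linarith
  rw [hones]
  congr 1
  -- count the set bits through `siteEquiv`
  have hc : (univ.filter fun x : V4 => Nat.testBit k (siteEquiv x) = true).card
      = (univ.filter fun i : Fin 16 => Nat.testBit k i = true).card := by
    apply Finset.card_bij (fun x _ => siteEquiv x)
    · intro x hx; simpa using hx
    · intro x _ y _ h; exact siteEquiv.injective h
    · intro i hi; exact ⟨siteEquiv.symm i, by simpa using hi, by simp⟩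
  rw [hc, bitCount_eq, Finset.card_filter, ← Fin.sum_univ_eq_sum_range (fun i => if Nat.testBit k i = true then 1 else 0) 16]

/-- the kernel's `pop16` is the bit count (kernel fact `pop16_spec`). [folklore] -/
theorem pop16_eq_bitCount (k : ℕ) (hk : k < 65536) : pop16 k = bitCount k := by
  have h := allN_sound pop16_spec (k / 256) (by omega)
  have h' := allN_sound h (k % 256) (Nat.mod_lt _ (by norm_num))
  rw [beq_iff_eq] at h'
  rwa [show 256 * (k / 256) + k % 256 = k from Nat.div_add_mod k 256] at h'

/-- the adjacency table is the torus adjacency (through `siteEquiv`). [folklore] -/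
theorem adj16_iff (x y : V4) : adj16 (siteEquiv x) (siteEquiv y) = true ↔ (torusGraph 2 4).Adj x y := by
  have key : ∀ i j : Fin 16, adj16 i j = true ↔ (torusGraph 2 4).Adj (siteEquiv.symm i) (siteEquiv.symm j) := by
    decide
  have := key (siteEquiv x) (siteEquiv y)
  rwa [Equiv.symm_apply_apply, Equiv.symm_apply_apply] at this

/-- the degree sum of the `4 × 4` torus: `Σ_x Σ_y [x ∼ y] = 64`. [folklore] -/
theorem torus4_degree_sum : (∑ x : V4, ∑ y : V4, if (torusGraph 2 4).Adj x y then (1:ℝ) else 0) = 64 := by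
  have h : (∑ x : V4, ∑ y : V4, if (torusGraph 2 4).Adj x y then (1:ℕ) else 0) = 64 := by decide
  have := congrArg (fun n : ℕ => (n : ℝ)) h
  push_cast at this
  exact this




/-! ## Site permutations -/

/-- the kernel fact `siteMap_spec`, unpacked. [folklore] -/
theorem siteMap_facts {p m i : ℕ} (hp : p < 24) (hm : m < 16) (hi : i < 16) :
    siteMap p m i < 16 ∧ siteInv p m i < 16 ∧ siteInv p m (siteMap p m i) = i ∧ siteMap p m (siteInv p m i) = i ∧
      ∀ j < 16, adj16 (siteMap p m i) (siteMap p m j) = adj16 i j := by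
  have h := allN_sound (allN_sound (allN_sound siteMap_spec p hp) m hm) i hi
  simp only [Bool.and_eq_true, decide_eq_true_eq, beq_iff_eq] at h
  obtain ⟨⟨⟨⟨h1, h2⟩, h3⟩, h4⟩, h5⟩ := h
  exact ⟨h1, h2, h3, h4, fun j hj => by have := allN_sound h5 j hj; rwa [beq_iff_eq] at this⟩

/-- the site permutation of the symmetry `(p, m)` as an equivalence of the torus sites. [folklore] -/
def sitePerm (p m : ℕ) (hp : p < 24) (hm : m < 16) : V4 ≃ V4 where
  toFun x := siteEquiv.symm ⟨siteMap p m (siteEquiv x), (siteMap_facts hp hm (siteEquiv x).isLt).1⟩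
  invFun x := siteEquiv.symm ⟨siteInv p m (siteEquiv x), (siteMap_facts hp hm (siteEquiv x).isLt).2.1⟩
  left_inv x := by
    apply siteEquiv.injective
    rw [Equiv.apply_symm_apply, Equiv.apply_symm_apply]
    exact Fin.ext (siteMap_facts hp hm (siteEquiv x).isLt).2.2.1
  right_inv x := by
    apply siteEquiv.injective
    rw [Equiv.apply_symm_apply, Equiv.apply_symm_apply]
    exact Fin.ext (siteMap_facts hp hm (siteEquiv x).isLt).2.2.2.1

/-- value of `sitePerm`. [folklore] -/
theorem siteEquiv_sitePerm {p m : ℕ} (hp : p < 24) (hm : m < 16) (x : V4) :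
    (siteEquiv (sitePerm p m hp hm x) : ℕ) = siteMap p m (siteEquiv x) := by
  simp [sitePerm]

/-- value of `sitePerm.symm`. [folklore] -/
theorem siteEquiv_sitePerm_symm {p m : ℕ} (hp : p < 24) (hm : m < 16) (x : V4) :
    (siteEquiv ((sitePerm p m hp hm).symm x) : ℕ) = siteInv p m (siteEquiv x) := by
  simp [sitePerm]

/-- the site permutation is a graph automorphism of the `4 × 4` torus. [folklore] -/
def siteIso (p m : ℕ) (hp : p < 24) (hm : m < 16) : torusGraph 2 4 ≃g torusGraph 2 4 :=
  { sitePerm p m hp hm with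
    map_rel_iff' := by
      intro x y
      change (torusGraph 2 4).Adj (sitePerm p m hp hm x) (sitePerm p m hp hm y) ↔ (torusGraph 2 4).Adj x y
      rw [← adj16_iff, ← adj16_iff]
      have hx := siteEquiv_sitePerm hp hm x
      have hy := siteEquiv_sitePerm hp hm y
      rw [show (siteEquiv (sitePerm p m hp hm x) : ℕ) = siteMap p m (siteEquiv x) from hx,
        show (siteEquiv (sitePerm p m hp hm y) : ℕ) = siteMap p m (siteEquiv y) from hy,
        (siteMap_facts hp hm (siteEquiv x).isLt).2.2.2.2 _ (siteEquiv y).isLt] }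

/-! ## Semantics of the code action -/

/-- bits of `moveBits`: bit `t` is set iff `t = siteMap p m i` for some set bit `i < 16` of `k`. [folklore] -/
theorem testBit_moveBits_iff (p m k t : ℕ) :
    Nat.testBit (moveBits p m k) t = true ↔ ∃ i < 16, Nat.testBit k i = true ∧ siteMap p m i = t := by
  unfold moveBits
  -- invariant along the loop
  suffices h : ∀ (n : ℕ) (acc : ℕ), Nat.testBit (iter n (fun i acc => bif Nat.testBit k i then acc ||| (1 <<< siteMap p m i) else acc) acc) t = true
      ↔ Nat.testBit acc t = true ∨ ∃ i < n, Nat.testBit k i = true ∧ siteMap p m i = t by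
    rw [h]; simp
  intro n
  induction n with
  | zero => intro acc; simp [iter_zero]
  | succ n ih =>
    intro acc
    rw [iter_succ, ih]
    cases hk : Nat.testBit k n with
    | false =>
      simp only [cond_false]
      constructor
      · rintro (h | ⟨i, hi, h1, h2⟩)
        · exact Or.inl h
        · exact Or.inr ⟨i, by omega, h1, h2⟩
      · rintro (h | ⟨i, hi, h1, h2⟩)
        · exact Or.inl h
        · rcases Nat.lt_succ_iff_lt_or_eq.1 hi with hi | rfl
          · exact Or.inr ⟨i, hi, h1, h2⟩
          · rw [hk] at h1; exact absurd h1 Bool.false_ne_true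
    | true =>
      simp only [cond_true, Nat.one_shiftLeft, Nat.testBit_lor, Nat.testBit_two_pow, Bool.or_eq_true,
        decide_eq_true_eq]
      constructor
      · rintro ((h | h) | ⟨i, hi, h1, h2⟩)
        · exact Or.inl h
        · exact Or.inr ⟨n, by omega, hk, h⟩
        · exact Or.inr ⟨i, by omega, h1, h2⟩
      · rintro (h | ⟨i, hi, h1, h2⟩)
        · exact Or.inl (Or.inl h)
        · rcases Nat.lt_succ_iff_lt_or_eq.1 hi with hi | rfl
          · exact Or.inr ⟨i, hi, h1, h2⟩
          · exact Or.inl (Or.inr h2)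

/-- `moveBits` transports bit `i` to bit `siteMap p m i`. [folklore] -/
theorem testBit_moveBits {p m : ℕ} (hp : p < 24) (hm : m < 16) (k : ℕ) {i : ℕ} (hi : i < 16) :
    Nat.testBit (moveBits p m k) (siteMap p m i) = Nat.testBit k i := by
  apply Bool.eq_iff_iff.2
  rw [testBit_moveBits_iff]
  constructor
  · rintro ⟨j, hj, h1, h2⟩
    have : j = i := by
      have h3 := (siteMap_facts hp hm hj).2.2.1
      have h4 := (siteMap_facts hp hm hi).2.2.1
      rw [h2] at h3; rw [← h3, h4]
    rwa [this] at h1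
  · intro h; exact ⟨i, hi, h, rfl⟩

/-- `moveBits p m k < 2^16`. [folklore] -/
theorem moveBits_lt {p m : ℕ} (hp : p < 24) (hm : m < 16) (k : ℕ) : moveBits p m k < 65536 := by
  rw [show (65536 : ℕ) = 2 ^ 16 by norm_num]
  apply Nat.lt_pow_two_of_testBit
  intro t ht
  cases h : Nat.testBit (moveBits p m k) t with
  | false => rfl
  | true =>
    obtain ⟨i, hi, -, h2⟩ := (testBit_moveBits_iff p m k t).1 h
    have := (siteMap_facts hp hm hi).1
    omega

/-- **`moveBits` relabels the configuration by the automorphism:** `decode (moveBits p m k) = decode k ∘ (sitePerm p m)⁻¹`. [folklore] -/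
theorem decode_moveBits {p m : ℕ} (hp : p < 24) (hm : m < 16) (k : ℕ) :
    decode (moveBits p m k) = decode k ∘ ⇑(sitePerm p m hp hm).symm := by
  funext x
  simp only [Function.comp_apply, decode]
  have hx : (siteEquiv x : ℕ) = siteMap p m (siteInv p m (siteEquiv x)) :=
    ((siteMap_facts hp hm (siteEquiv x).isLt).2.2.2.1).symm
  rw [hx, testBit_moveBits hp hm k (siteMap_facts hp hm (siteEquiv x).isLt).2.1, siteEquiv_sitePerm_symm hp hm x]

/-- **the mask `2^16 − 1` flips all spins:** `decode (v ^^^ 65535) = flipAll (decode v)`. [folklore] -/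
theorem decode_flipMask (v : ℕ) : decode (v ^^^ 65535) = flipAll (decode v) := by
  funext x
  simp only [decode, flipAll, Nat.testBit_xor, show (65535 : ℕ) = 2 ^ 16 - 1 by norm_num, Nat.testBit_two_pow_sub_one,
    (siteEquiv x).isLt, decide_true, Bool.bne_true]
  cases Nat.testBit v (siteEquiv x) <;> simp

/-- xor with the mask keeps codes below `2^16`. [folklore] -/
theorem flipMask_lt {v : ℕ} (hv : v < 65536) : v ^^^ 65535 < 65536 := by
  rw [show (65536 : ℕ) = 2 ^ 16 by norm_num] at hv ⊢
  exact Nat.xor_lt_two_pow hv (by norm_num)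

/-- `actCode t k < 2^16` for `t < 768`. [folklore] -/
theorem actCode_lt {t : ℕ} (ht : t < 768) (k : ℕ) : actCode t k < 65536 := by
  unfold actCode
  have hp : t / 32 < 24 := by omega
  have hm : (t / 2) % 16 < 16 := Nat.mod_lt _ (by norm_num)
  cases (t % 2 == 1) <;> simp only [cond_true, cond_false]
  · exact moveBits_lt hp hm k
  · exact flipMask_lt (moveBits_lt hp hm k)

/-- even `t`: `decode (actCode t k) = decode k ∘ automorphism⁻¹`. [folklore] -/
theorem decode_actCode_even {t : ℕ} (ht : t < 768) (he : t % 2 = 0) (k : ℕ) :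
    decode (actCode t k) = decode k ∘ ⇑(sitePerm (t / 32) ((t / 2) % 16) (by omega) (Nat.mod_lt _ (by norm_num))).symm := by
  unfold actCode
  rw [show (t % 2 == 1) = false by rw [he]; rfl, cond_false]
  exact decode_moveBits _ _ k

/-- odd `t`: `decode (actCode t k) = flipAll (decode k ∘ automorphism⁻¹)`. [folklore] -/
theorem decode_actCode_odd {t : ℕ} (ht : t < 768) (ho : t % 2 = 1) (k : ℕ) :
    decode (actCode t k) = flipAll (decode k ∘ ⇑(sitePerm (t / 32) ((t / 2) % 16) (by omega) (Nat.mod_lt _ (by norm_num))).symm) := by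
  unfold actCode
  rw [show (t % 2 == 1) = true by rw [ho]; rfl, cond_true, decode_flipMask, decode_moveBits]

/-! ## Invariance of the Perron amplitude -/

/-- automorphism invariance, code form. [folklore] -/
theorem perron_comp_sitePerm_symm {Δ M : ℝ} {a : Cfg → ℝ} (ha : IsPerronSectorGroundAmplitude 4 Δ M a)
    {p m : ℕ} (hp : p < 24) (hm : m < 16) (σ : Cfg) : a (σ ∘ ⇑(sitePerm p m hp hm).symm) = a σ := by
  have h := perronAmplitude_comp_iso 4 Δ M a ha (siteIso p m hp hm).symm σ
  exact h

/-- flip invariance of the sector-`0` Perron amplitude. [folklore] -/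
theorem perron_flipAll {Δ : ℝ} {a : Cfg → ℝ} (ha : IsPerronSectorGroundAmplitude 4 Δ 0 a) (σ : Cfg) :
    a (flipAll σ) = a σ := by
  have hb : IsPerronSectorGroundAmplitude 4 Δ (-0) a := by rw [neg_zero]; exact ha
  have h := perron_neg_eq_flip ha hb
  exact (congrFun h σ).symm ▸ rfl

/-- **the sector-`0` Perron amplitude is constant along the code action:** `a (decode (actCode t k)) = a (decode k)`
(`t < 768`). [folklore] -/
theorem perron_decode_actCode {Δ : ℝ} {a : Cfg → ℝ} (ha : IsPerronSectorGroundAmplitude 4 Δ 0 a) {t : ℕ} (ht : t < 768)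
    (k : ℕ) : a (decode (actCode t k)) = a (decode k) := by
  rcases Nat.mod_two_eq_zero_or_one t with he | ho
  · rw [decode_actCode_even ht he, perron_comp_sitePerm_symm ha]
  · rw [decode_actCode_odd ht ho, perron_flipAll ha, perron_comp_sitePerm_symm ha]

/-- for EVEN `t` the value of any automorphism-invariant function of configurations is preserved. [folklore] -/
theorem decode_actCode_even_comp {β : Type} (F : Cfg → β) (hF : ∀ (φ : torusGraph 2 4 ≃g torusGraph 2 4) (σ : Cfg), F (σ ∘ ⇑φ) = F σ)
    {t : ℕ} (ht : t < 768) (he : t % 2 = 0) (k : ℕ) : F (decode (actCode t k)) = F (decode k) := by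
  rw [decode_actCode_even ht he]
  exact hF (siteIso (t / 32) ((t / 2) % 16) (by omega) (Nat.mod_lt _ (by norm_num))).symm (decode k)


end Summit.HubbardSuperconductivity.HubbardSuperconductivity.Theorems.AnisotropyChord.FourTorus
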